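import Literature.NumberTheory.Automorphic.Liu2021.AlbaneseBaseChangeFiniteGalois
import Literature.AlgebraicGeometry.Motives.JacobianBaseChangeSurjective
import Literature.AlgebraicGeometry.Motives.JacobianOfIso
import Literature.AlgebraicGeometry.Motives.FiberBaseChange
import Literature.AlgebraicGeometry.Motives.AbelianVarietyIsoOfScheme
import HarnessLib

/-!
# The complex base change of an Albanese variety is JOINTLY COVERED by the complex Albanese varieties
# of the pieces (Liu 2021, §2.1 with Lemma 2.4 (1): «`Alb_X ⊗_{k,τ} ℂ`» versus `Alb_{X ⊗_{k,τ} ℂ}`)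

[Liu2021] = Yifeng Liu, *Fourier–Jacobi cycles and arithmetic relative trace formula*, Camb. J. Math.
**9** (2021) = arXiv:2102.11518 (`l. NNNN` = lines of `FJcycle.tex`).  For a proper smooth `X / k` Liu's
Albanese datum is `α_X : ∇X → Alb_X` (Def. 2.3, `AppendixC.Albanese X`); the proof of Lemma 2.4 (1)
(l. 1220–1228) silently uses that `Alb_X ⊗_{k,τ} ℂ` is the Albanese variety of `X ⊗_{k,τ} ℂ` — the
base-change theorem for the Albanese variety (Grothendieck, FGA VI Thm. 3.3 (iii)), recorded in the
tree as the NAMED FACT `Liu2021.albanese_baseChange` (`Liu2021/AlbaneseBaseChangeFact`).  This file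
PROVES, with no named fact, the WEAKER statement that the consumer of that fact actually uses:

* `Albanese.exists_jacobian_hom_baseChange_of_ne_zero` — for `X` smooth of relative dimension `d` and
  projective over a field `k` of characteristic zero with `k → ℂ` (`[Algebra k ℂ]`), ANY Albanese datum `a` of `X`, and
  ANY finite coproduct decomposition `inj_c : Y_c ⟶ X ⊗_{k,σ} ℂ` into smooth projective geometrically
  irreducible complex varieties: there are complex Albanese data `𝒥_c : Motives.Jacobian (Y c)` and
  homomorphisms `ι_c : J(Y_c) ⟶ Alb_X ⊗_{k,σ} ℂ` which are JOINTLY EPIMORPHIC — every non-zero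
  homomorphism `w : Alb_X ⊗_{k,σ} ℂ ⟶ B` has `ι_c ≫ w ≠ 0` for some `c`.

(The named fact would give more: `Alb_X ⊗_{k,σ} ℂ ≅ ∏_c J(Y_c)`.)  Proof, all inputs tree theorems:
over a finite Galois splitting field `L / k` with pointed pieces `E_j`, `Alb_X ⊗_k L ≅ ∏_j J(E_j)`
for ANY datum (`Albanese.exists_isGalois_isLimit_fan_baseChange`), whence sections
`s_j : J(E_j) → Alb_X ⊗_k L` with `∑_j π_j ≫ s_j = 1` (Mumford §19: a finite product of abelian varieties
is a biproduct); along a `k`-embedding `τ : L → ℂ` over `σ`, `(Alb_X ⊗_k L) ⊗_{L,τ} ℂ ≅ Alb_X ⊗_{k,σ} ℂ`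
(transitivity of base change; an isomorphism of the underlying varieties of abelian varieties is one of
abelian varieties up to translation, `AbelianVariety.isoOfOverIso'`) and `∑_j (π_j)_ℂ ≫ (s_j)_ℂ = 1`;
each `J(E_j) ⊗_{L,τ} ℂ` receives a SURJECTION `u_j` from the complex Albanese variety of `E_j ⊗_{L,τ} ℂ`
(`Jacobian.exists_jacobian_hom_baseChange_surjective_complex`: the Abel–Jacobi map of the rational point
generates, generation survives base change, Serre), and a surjection kills no non-zero homomorphism
(`AbelianVariety.eq_zero_of_surjective_comp_eq_zero`); finally the `E_j ⊗_{L,τ} ℂ` and the `Y_c` are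
both the connected components of `X ⊗_{k,σ} ℂ` (clopen connected images partitioning it), so they match
up to isomorphism (`IsOpenImmersion.isoOfRangeEq`) and Albanese data transport (`Jacobian.nonempty_iso_J_of_iso`).

Use (cell pub-hodgecm2, TEAM hComp): the `hAlb` binder of the COR-CM `hComp` closer
(`Transposition/Item6PinReachAlong.lean`) is consumed only through «a non-zero homomorphism out of
`Alb_{X_K} ⊗_E ℂ` is non-zero on the Albanese variety of some piece» (`Item6PinReach.lean`,
`CMReach.exists_inj_comp_ne_zero`); this file supplies exactly that, WITHOUT the named fact.
Everything is proved; no definition, no named fact (D-0026).  HC_CM is NOT proved.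

## References

* [Liu2021] Y. Liu, arXiv:2102.11518 = Camb. J. Math. 9 (2021): §2.1 Proposition 2.2 (l. 1190–1192) with
  proof (l. 1194–1200), Def. 2.3 (l. 1202–1208), Lemma 2.4 (1) (l. 1211–1213, proof l. 1220–1228) — compiled
  numbering of `FJcycle.tex` (shared counter; red-team erratum F-24: «Lemma 2.4», not «2.2»).
* [MumfordAV1970] D. Mumford, *Abelian Varieties* (1970), §19 Thm. 1 Cor. 1 (p. 173), §4.
* [Serre1958MorphismesUniversels] J.-P. Serre, Sém. Chevalley 4 (1958/59), exp. 10, no. 2.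
* [GortzWedhorn2020] U. Görtz, T. Wedhorn, *Algebraic Geometry I*, 2nd ed., Prop. 4.16 (transitivity
  of base change), §(3.5) Example 3.11 (coproducts of schemes).
-/

noncomputable section

open CategoryTheory CategoryTheory.Limits AlgebraicGeometry MonoidalCategory CartesianMonoidalCategory
open Literature.AlgebraicGeometry.Motives

namespace Literature.NumberTheory.Automorphic.Liu2021.AppendixC

open AbelianVariety (bcSpec bcFunctor)

set_option backward.isDefEq.respectTransparency false

/-! ### Matching two decompositions into connected open-closed pieces -/

/-- Two families of connected open-closed subsets, the first of which covers the space: every member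
of the second family EQUALS some member of the first (a preconnected set meeting an open-closed set
lies inside it, Mathlib `IsPreconnected.subset_isClopen`, both ways). [folklore] -/
private theorem exists_eq_of_isClopen_of_isConnected {α : Type*} [TopologicalSpace α] {ι κ : Type*}
    {A : ι → Set α} {B : κ → Set α} (hAc : ∀ i, IsClopen (A i)) (hAconn : ∀ i, _root_.IsConnected (A i))
    (hAcov : ∀ x, ∃ i, x ∈ A i) (hBc : ∀ j, IsClopen (B j)) (hBconn : ∀ j, _root_.IsConnected (B j)) (j : κ) :
    ∃ i, A i = B j := by
  obtain ⟨x, hx⟩ := (hBconn j).nonempty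
  obtain ⟨i, hi⟩ := hAcov x
  exact ⟨i, Set.Subset.antisymm ((hAconn i).isPreconnected.subset_isClopen (hBc j) ⟨x, hi, hx⟩)
    ((hBconn j).isPreconnected.subset_isClopen (hAc i) ⟨x, hx, hi⟩)⟩

/-- The image of `g ≫ i` for an isomorphism `i` of schemes is the preimage of the image of `g` under
`i⁻¹`. [folklore] -/
private theorem range_comp_left_eq_preimage {K : Type} [Field K] {W X₁ X₂ : SchemeOver K} (g : W ⟶ X₁)
    (i : X₁ ≅ X₂) : Set.range ⇑(g ≫ i.hom).left = ⇑i.inv.left ⁻¹' Set.range ⇑g.left := by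
  have h1 : ∀ z, i.inv.left (i.hom.left z) = z := fun z => by
    rw [← Scheme.Hom.comp_apply, ← Over.comp_left, i.hom_inv_id, Over.id_left]; rfl
  have h2 : ∀ z, i.hom.left (i.inv.left z) = z := fun z => by
    rw [← Scheme.Hom.comp_apply, ← Over.comp_left, i.inv_hom_id, Over.id_left]; rfl
  ext x
  constructor
  · rintro ⟨y, rfl⟩
    exact ⟨y, by rw [Over.comp_left, Scheme.Hom.comp_apply, h1]⟩
  · rintro ⟨y, hy⟩
    exact ⟨y, by rw [Over.comp_left, Scheme.Hom.comp_apply, hy, h2]⟩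

/-! ### The main theorem -/

/-- **The complex base change of the Albanese variety is jointly covered by the complex Albanese
varieties of the pieces.**  `X` smooth of relative dimension `d` and projective over a field `k` of
characteristic zero with `[Algebra k ℂ]` (`σ = algebraMap k ℂ`), `a` ANY Albanese datum of `X` (Def. 2.3), `inj_c : Y_c ⟶ X ⊗_{k,σ} ℂ`
ANY finite colimit cofan of smooth projective geometrically irreducible complex varieties: there are
Albanese data `𝒥_c` of the `Y_c` (Milne's difference-map form) and homomorphisms
`ι_c : J(Y_c) ⟶ Alb_X ⊗_{k,σ} ℂ` such that every non-zero `w : Alb_X ⊗_{k,σ} ℂ ⟶ B` has `ι_c ≫ w ≠ 0` for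
some `c`.  See the module docstring for the proof.  This is the part of «`Alb_X ⊗_{k,τ} ℂ` is the Albanese
variety of `X ⊗_{k,τ} ℂ`» (used in the proof of Lemma 2.4 (1), l. 1220–1228; Grothendieck FGA VI 3.3 (iii))
that the COR-CM consumer needs, proved without that theorem.  Ours.
[cite: Liu2021, §2.1 Proposition (l. 1190–1192) with proof (l. 1194–1200) and Lemma 2.4 (1) (proof, l. 1220–1228)]
[cite: MumfordAV1970, §19 Thm. 1 Cor. 1 (p. 173)] [cite: Serre1958MorphismesUniversels, no. 2 Thm. 1 and proof of Thm. 2] -/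
theorem Albanese.exists_jacobian_hom_baseChange_of_ne_zero {k : Type} [Field k] [CharZero k]
    [Algebra k ℂ] {d : ℕ} (X : SchemeOver k) [SmoothOfRelativeDimension d X.hom] (hX : IsProjectiveOver X)
    (a : Albanese X) {κ : Type} [Fintype κ] (Y : κ → SchemeOver ℂ)
    (inj : ∀ c, Y c ⟶ (bcFunctor k ℂ).obj X) {n : ℕ} (hY : ∀ c, IsSmoothProjective n (Y c))
    (hcol : IsColimit (Cofan.mk ((bcFunctor k ℂ).obj X) inj)) :
    ∃ (𝒥 : ∀ c, Jacobian (Y c)) (ι : ∀ c, (𝒥 c).J ⟶ a.Alb.baseChange ℂ),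
      ∀ (B : AbelianVariety ℂ) (w : a.Alb.baseChange ℂ ⟶ B), w ≠ 0 → ∃ c, ι c ≫ w ≠ 0 := by
  classical
  -- §A  over a finite Galois splitting field `L`: `Alb_X ⊗ L ≅ ∏_j J(E_j)`, pointed pieces
  obtain ⟨L, _, _, _, _, C, _, E, e, hE, ⟨hcolL⟩, P, 𝒥L, π, ⟨hlim⟩⟩ :=
    a.exists_isGalois_isLimit_fan_baseChange (d := d) X hX
  -- a `k`-embedding `τ : L → ℂ` over `σ`
  set τ : L →ₐ[k] ℂ := IsAlgClosed.lift with hτdef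
  letI : Algebra L ℂ := (τ : L →+* ℂ).toAlgebra
  have hτ : (τ : L →+* ℂ).comp (algebraMap k L) = algebraMap k ℂ := τ.comp_algebraMap
  -- §B  sections of the product over `L` (a finite product of abelian varieties is a biproduct)
  let b : Bicone (fun j => (𝒥L j).J) := Bicone.ofLimitCone hlim
  have hb : b.IsBilimit := biconeIsBilimitOfLimitConeOfIsLimit hlim
  let s : ∀ j, (𝒥L j).J ⟶ a.Alb.baseChange L := fun j => b.ι j
  have htot : ∑ j, π j ≫ s j = 𝟙 (a.Alb.baseChange L) := IsBilimit.total hb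
  -- base change `L → ℂ` along `τ`
  set G := AbelianVariety.baseChangeFunctor L ℂ with hG
  have htotℂ : ∑ j, G.map (π j) ≫ G.map (s j) = 𝟙 (G.obj (a.Alb.baseChange L)) := by
    have h := congrArg G.map htot
    rw [G.map_sum, G.map_id] at h
    simpa only [G.map_comp] using h
  -- §C  `(Alb_X ⊗_k L) ⊗_{L,τ} ℂ ≅ Alb_X ⊗_{k,σ} ℂ`
  let εX : ((a.Alb.baseChange L).baseChange ℂ).X ≅ (a.Alb.baseChange ℂ).X :=
    baseChangeHomObjIsoOfComp (algebraMap k L) (τ : L →+* ℂ) (algebraMap k ℂ) hτ a.Alb.X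
  let ε : (a.Alb.baseChange L).baseChange ℂ ≅ a.Alb.baseChange ℂ := AbelianVariety.isoOfOverIso' εX
  -- §D  complex Albanese data of the pieces `E_j ⊗_{L,τ} ℂ`, mapping ONTO `J(E_j) ⊗_{L,τ} ℂ`
  have hsurj := fun j => Jacobian.exists_jacobian_hom_baseChange_surjective_complex (hE j) (𝒥L j) (P j)
  choose 𝒥ℂ u hu using hsurj
  -- §E  the pieces `E_j ⊗ ℂ` inside `X ⊗_{k,σ} ℂ`
  let eX : (bcFunctor L ℂ).obj ((bcFunctor k L).obj X) ≅ (bcFunctor k ℂ).obj X :=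
    baseChangeHomObjIsoOfComp (algebraMap k L) (τ : L →+* ℂ) (algebraMap k ℂ) hτ X
  let f : ∀ j, (bcFunctor L ℂ).obj (E j) ⟶ (bcFunctor k ℂ).obj X := fun j => (bcFunctor L ℂ).map (e j) ≫ eX.hom
  haveI hoe : ∀ j, IsOpenImmersion (e j).left := fun j => isOpenImmersion_left_of_isColimit hcolL j
  haveI hof : ∀ j, IsOpenImmersion (f j).left := fun j => by
    haveI := GaloisDescent.isOpenImmersion_bcFunctor_map_left ℂ (e j)
    change IsOpenImmersion (((bcFunctor L ℂ).map (e j)).left ≫ eX.hom.left)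
    infer_instance
  have hrange : ∀ j, Set.range ⇑(f j).left =
      ⇑eX.inv.left ⁻¹' (⇑(pullback.fst ((bcFunctor k L).obj X).hom (bcSpec L ℂ)) ⁻¹' Set.range ⇑(e j).left) :=
    fun j => by rw [range_comp_left_eq_preimage, GaloisDescent.range_bcFunctor_map_left]
  have hfclopen : ∀ j, IsClopen (Set.range ⇑(f j).left) := fun j => by
    rw [hrange j]
    exact ((isClopen_range_left_of_isColimit hcolL j).preimage (Scheme.Hom.continuous _)).preimage
      (Scheme.Hom.continuous _)
  have hfconn : ∀ j, _root_.IsConnected (Set.range ⇑(f j).left) := fun j => by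
    haveI : GeometricallyIrreducible ((bcFunctor L ℂ).obj (E j)).hom :=
      ((hE j).baseChange_obj ℂ).geometricallyIrreducible
    haveI : IrreducibleSpace ↥((bcFunctor L ℂ).obj (E j)).left :=
      GeometricallyIrreducible.irreducibleSpace_of_subsingleton ((bcFunctor L ℂ).obj (E j)).hom
    exact isConnected_range (f j).left.continuous
  have hfcov : ∀ x : ↥((bcFunctor k ℂ).obj X).left, ∃ j, x ∈ Set.range ⇑(f j).left := fun x => by
    obtain ⟨j, y, hy⟩ := exists_eq_left_of_isColimit hcolL
      (pullback.fst ((bcFunctor k L).obj X).hom (bcSpec L ℂ) (eX.inv.left x))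
    exact ⟨j, by rw [hrange j]; exact ⟨y, hy⟩⟩
  have hfdisj : ∀ {j j' : C}, j ≠ j' → Disjoint (Set.range ⇑(f j).left) (Set.range ⇑(f j').left) :=
    fun {j j'} h => by
      rw [hrange j, hrange j']
      exact ((disjoint_range_left_of_isColimit hcolL h).preimage _).preimage _
  -- the consumer's pieces `Y_c`
  haveI hoinj : ∀ c, IsOpenImmersion (inj c).left := fun c => isOpenImmersion_left_of_isColimit hcol c
  have hYclopen : ∀ c, IsClopen (Set.range ⇑(inj c).left) := fun c => isClopen_range_left_of_isColimit hcol c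
  have hYconn : ∀ c, _root_.IsConnected (Set.range ⇑(inj c).left) := fun c => by
    haveI : GeometricallyIrreducible (Y c).hom := (hY c).geometricallyIrreducible
    haveI : IrreducibleSpace ↥(Y c).left := GeometricallyIrreducible.irreducibleSpace_of_subsingleton (Y c).hom
    exact isConnected_range (inj c).left.continuous
  have hYcov : ∀ x : ↥((bcFunctor k ℂ).obj X).left, ∃ c, x ∈ Set.range ⇑(inj c).left := fun x => by
    obtain ⟨c, y, hy⟩ := exists_eq_left_of_isColimit hcol x
    exact ⟨c, y, hy⟩
  -- §F  matching: every `Y_c` is some `E_{j(c)} ⊗ ℂ`, and every `E_j ⊗ ℂ` is hit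
  have hmatch : ∀ c, ∃ j, Set.range ⇑(f j).left = Set.range ⇑(inj c).left := fun c =>
    exists_eq_of_isClopen_of_isConnected hfclopen hfconn hfcov hYclopen hYconn c
  choose jOf hjOf using hmatch
  have hhit : ∀ j, ∃ c, jOf c = j := fun j => by
    obtain ⟨c, hc⟩ := exists_eq_of_isClopen_of_isConnected hYclopen hYconn hYcov hfclopen hfconn j
    refine ⟨c, ?_⟩
    by_contra hne
    have hd := hfdisj hne
    rw [hjOf c, ← hc, Set.disjoint_iff_inter_eq_empty, Set.inter_self] at hd
    exact (hYconn c).nonempty.ne_empty hd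
  -- isomorphisms `E_{j(c)} ⊗ ℂ ≅ Y_c` over `ℂ`, complex Albanese data of the `Y_c`, transport
  have hisoY : ∀ c, Nonempty ((bcFunctor L ℂ).obj (E (jOf c)) ≅ Y c) := fun c => by
    let i₀ := IsOpenImmersion.isoOfRangeEq (f (jOf c)).left (inj c).left (hjOf c)
    have hfac : i₀.hom ≫ (inj c).left = (f (jOf c)).left := IsOpenImmersion.isoOfRangeEq_hom_fac _ _ _
    refine ⟨Over.isoMk i₀ ?_⟩
    rw [← Over.w (inj c), ← Category.assoc, hfac]
    exact Over.w (f (jOf c))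
  have 𝒥 : ∀ c, Jacobian (Y c) := fun c =>
    (nonempty_jacobian_of_isSmoothProjective_complex_of_dim (Y c) (hY c)).some
  have hm : ∀ c, Nonempty ((𝒥 c).J ≅ (𝒥ℂ (jOf c)).J) := fun c =>
    (𝒥ℂ (jOf c)).nonempty_iso_J_of_iso (𝒥 c) (hisoY c).some
  -- §G  the homomorphisms `ι_c` and the joint epimorphy
  refine ⟨𝒥, fun c => (hm c).some.hom ≫ u (jOf c) ≫ G.map (s (jOf c)) ≫ ε.hom, fun B w hw => ?_⟩
  -- `w ≠ 0` ⇒ `ε ≫ w ≠ 0` ⇒ some `(s_j)_ℂ ≫ ε ≫ w ≠ 0`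
  have hw' : ε.hom ≫ w ≠ 0 := fun h => hw (by
    rw [← Category.id_comp w, ← ε.inv_hom_id, Category.assoc, h, comp_zero])
  have hj : ∃ j, G.map (s j) ≫ ε.hom ≫ w ≠ 0 := by
    by_contra hall
    push Not at hall
    apply hw'
    calc ε.hom ≫ w = (∑ j, G.map (π j) ≫ G.map (s j)) ≫ (ε.hom ≫ w) := by rw [htotℂ]; exact (Category.id_comp _).symm
      _ = ∑ j, G.map (π j) ≫ (G.map (s j) ≫ ε.hom ≫ w) := by rw [Preadditive.sum_comp]; simp only [Category.assoc]
      _ = 0 := Finset.sum_eq_zero fun j _ => by rw [hall j, comp_zero]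
  obtain ⟨j, hj⟩ := hj
  obtain ⟨c, rfl⟩ := hhit j
  refine ⟨c, fun h => ?_⟩
  -- the surjection `u` kills no non-zero homomorphism; isomorphisms neither
  haveI := hu (jOf c)
  have h1 : u (jOf c) ≫ (G.map (s (jOf c)) ≫ ε.hom ≫ w) = 0 := by
    have h2 := congrArg (fun t => (hm c).some.inv ≫ t) h
    simpa only [Iso.inv_hom_id_assoc, Category.assoc, comp_zero] using h2
  exact hj (AbelianVariety.eq_zero_of_surjective_comp_eq_zero (u (jOf c)) h1)

/-- **The same, packaged for the consumer** (an explicit embedding `σ : k →+* ℂ`, `X` projective and smooth of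
some relative dimension `m` — the attributes printed for Liu's `X_K = S̃h(𝕍)_K`, §4.2 l. 2064 — and a
`Nonempty (IsColimit _)` hypothesis): the drop-in replacement of
`Liu2021.exists_jacobian_isLimit_fan_baseChange_of_isProjectiveOver` (`Liu2021/AlbaneseBaseChange.lean`, which
takes the named fact `albanese_baseChange_isLimit_fan_jacobian`) in the jointly-epimorphic shape, with NO named
fact.  Ours. [cite: Liu2021, §4.2 (FJcycle.tex l. 2060–2066), §2.1 Proposition (l. 1190–1200) and Lemma 2.4 (1) (l. 1220–1228)] -/
theorem Albanese.exists_jacobian_hom_baseChange_of_ne_zero_of_isProjectiveOver {k : Type} [Field k]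
    [CharZero k] (σ : k →+* ℂ) (X : SchemeOver k) {m : ℕ} (hXp : IsProjectiveOver X)
    (hXs : SmoothOfRelativeDimension m X.hom) (a : Albanese X) (n : ℕ) {κ : Type} [Fintype κ]
    (Y : κ → SchemeOver ℂ) (inj : ∀ c, Y c ⟶ (baseChangeHom σ).obj X) (hY : ∀ c, IsSmoothProjective n (Y c))
    (hcol : Nonempty (IsColimit (Cofan.mk ((baseChangeHom σ).obj X) inj))) :
    ∃ (𝒥 : ∀ c, Jacobian (Y c)) (ι : ∀ c, (𝒥 c).J ⟶ (letI := σ.toAlgebra; a.Alb.baseChange ℂ)),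
      ∀ (B : AbelianVariety ℂ) (w : (letI := σ.toAlgebra; a.Alb.baseChange ℂ) ⟶ B), w ≠ 0 →
        ∃ c, ι c ≫ w ≠ 0 := by
  letI : Algebra k ℂ := σ.toAlgebra
  haveI := hXs
  exact Albanese.exists_jacobian_hom_baseChange_of_ne_zero (d := m) X hXp a Y inj hY hcol.some

end Literature.NumberTheory.Automorphic.Liu2021.AppendixC

end
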